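import Summits.QuantumFields.GaugeBoot.TiltedBoxOddAxisWitness
import HarnessLib

/-!
# The square tilted box in two dimensions: layers are cycles, the slab is an annulus (gauge-boot, L3 supplement: 2D slab gluing 2/5)

HONEST FRAMING (cell `pub-gaugeboot`, page 1 of every file): the venture produces certified bounds
on lattice expectations at stated coupling, gauge group, dimension and torus size; NOT a mass gap,
NOT a continuum limit, NOT a string tension; NOT Yang–Mills-summit-bearing (barriers
`FixedCouplingUltralocality`, `PerturbativeInvisibility`). Geometric bookkeeping for the POSITIVE
two-dimensional result `TiltedBoxOddAxisRPTwoDim.lean`; it discharges nothing else.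

Setting: the square tilted box `ℤ^d / Γ(M, M, L)` of `TiltedBox.lean` (`Γ = {2M ∣ x_i + x_j,
2M ∣ x_i - x_j, L ∣ x_k (k ∉ {i, j})}`), its coordinate `x_i mod M` (`axisCoord`,
`TiltedBoxOddAxisGeometry.lean`), the axis flip `Θ_i : x_i ↦ -x_i` (`tiltedAxisFlip`) and the
half-period translation `T = [M e_j]` (`tiltedTwist`). "Two-dimensional" is the hypothesis
`∀ k, k = i ∨ k = j` on the directions (with `i ≠ j` this forces `d = 2` up to relabelling; it keeps
the whole `TiltedSite d i j` vocabulary available).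

Contents (elementary; no measure theory):
* multiples of `e_j`: `n • e_j = 0 ↔ 2M ∣ n`, `T = M • e_j`, `x_i(n • e_j) = 0`; the layer `x_i ≡ 0`
  is fixed POINTWISE by `Θ_i` (`tiltedAxisFlip_eq_self_of_axisCoord_eq_zero`, every `M`);
* two dimensions: the kernel of `x_i` is the cyclic group `⟨e_j⟩ ≅ ℤ/2M`, so every layer
  `{x_i ≡ a}` is ONE cycle `t ↦ y + t • e_j` (`t < 2M`) of length `2M` (`cyc`, `cyc_inj`,
  `filter_axisCoord_eq_image_cyc`); there is one direction pair (`dirPair_eq_dp`), every plaquette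
  has an `i`-side;
* the odd box `M = 2P + 1` (blocks of links, the annulus of slab plaquettes, the twist along the
  cycle) is `TiltedBoxTwoDimBlocks.lean`.

References: J. Fröhlich, R. Israel, E. H. Lieb, B. Simon, J. Stat. Phys. 22 (1980) 297, §3;
M. Biskup, in LNM 1970 (2009) §5.4 (the diagonal torus).
-/

noncomputable section

open QuotientAddGroup Finset

namespace Summit.QuantumFields.GaugeBoot

namespace TiltedRP

namespace TwoDim

variable (d : ℕ) {i j : Fin d} (L M : ℕ)

/-! ## Multiples of `e_j` -/

/-- `n • e_k` is the class of `n` times the unit vector. [folklore] -/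
theorem zsmul_tiltedUnit (k : Fin d) (n : ℤ) :
    n • tiltedUnit d i j M M L k = ((Pi.single k n : Fin d → ℤ) : TiltedSite d i j M M L) := by
  rw [tiltedUnit, ← QuotientAddGroup.mk_zsmul]
  congr 1
  funext m
  by_cases hm : m = k
  · subst hm; simp
  · simp [Pi.single_eq_of_ne hm]

/-- **`n • e_j = 0 ↔ 2M ∣ n`** in the square box (`x_i + x_j = n` must be divisible by `2M`). [folklore] -/
theorem zsmul_tiltedUnit_right_eq_zero_iff (hij : i ≠ j) (n : ℤ) :
    n • tiltedUnit d i j M M L j = 0 ↔ ((2 * M : ℕ) : ℤ) ∣ n := by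
  rw [zsmul_tiltedUnit, QuotientAddGroup.eq_zero_iff, mem_tiltedLattice_iff]
  simp only [Pi.single_eq_of_ne hij, Pi.single_eq_same, zero_add, zero_sub, dvd_neg]
  constructor
  · rintro ⟨h, -, -⟩; exact h
  · intro h
    exact ⟨h, h, fun k hki hkj => by rw [Pi.single_eq_of_ne hkj]; exact dvd_zero _⟩

/-- `(2M) • e_j = 0`. [folklore] -/
theorem two_mul_zsmul_tiltedUnit_right (hij : i ≠ j) :
    ((2 * M : ℕ) : ℤ) • tiltedUnit d i j M M L j = 0 :=
  (zsmul_tiltedUnit_right_eq_zero_iff d L M hij _).2 dvd_rfl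

/-- The twist is `M • e_j`. [folklore] -/
theorem tiltedTwist_eq_zsmul : (tiltedTwist d L M : TiltedSite d i j M M L) = (M : ℤ) • tiltedUnit d i j M M L j := by
  rw [zsmul_tiltedUnit, tiltedTwist]

/-- `x_i(n • e_j) = 0`. [folklore] -/
theorem axisCoord_zsmul_tiltedUnit_right (hij : i ≠ j) (n : ℤ) :
    axisCoord d L M (n • tiltedUnit d i j M M L j) = 0 := by
  rw [map_zsmul, axisCoord_tiltedUnit_of_ne d L M (Ne.symm hij), smul_zero]

/-- **The layer `x_i ≡ 0` is fixed pointwise by the flip** (`2 x_i e_i ∈ Γ` when `M ∣ x_i`), on the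
square box of every side `M`. [folklore] -/
theorem tiltedAxisFlip_eq_self_of_axisCoord_eq_zero (hij : i ≠ j) (q : TiltedSite d i j M M L)
    (hq : axisCoord d L M q = 0) : tiltedAxisFlip d L M hij q = q := by
  induction q using QuotientAddGroup.induction_on with
  | H x =>
    rw [axisCoord_mk, ZMod.intCast_zmod_eq_zero_iff_dvd] at hq
    obtain ⟨a, ha⟩ := hq
    rw [tiltedAxisFlip_mk, QuotientAddGroup.eq, mem_tiltedLattice_iff]
    simp only [Pi.add_apply, Pi.neg_apply, negHom_apply, if_neg (Ne.symm hij)]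
    refine ⟨⟨a, ?_⟩, ⟨a, ?_⟩, fun k hki hkj => ?_⟩
    · rw [ha]; push_cast; ring
    · rw [ha]; push_cast; ring
    · rw [if_neg hki]; simp

/-! ## The cycle `t ↦ y + t • e_j` -/

variable {d L M}

/-- The cycle through `y` along `e_j`: `cyc y t = y + t • e_j`. -/
def cyc (y : TiltedSite d i j M M L) (t : ℕ) : TiltedSite d i j M M L := y + (t : ℤ) • tiltedUnit d i j M M L j

/-- `cyc y 0 = y`. [folklore] -/
@[simp] theorem cyc_zero (y : TiltedSite d i j M M L) : cyc y 0 = y := by simp [cyc]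

/-- One step along the cycle. [folklore] -/
theorem cyc_succ (y : TiltedSite d i j M M L) (t : ℕ) : cyc y (t + 1) = cyc y t + tiltedUnit d i j M M L j := by
  simp only [cyc, Nat.cast_add, Nat.cast_one, add_zsmul, one_zsmul, add_assoc]

/-- Adding steps along the cycle. [folklore] -/
theorem cyc_add (y : TiltedSite d i j M M L) (s t : ℕ) : cyc y (s + t) = cyc (cyc y s) t := by
  simp only [cyc, Nat.cast_add, add_zsmul, add_assoc]

/-- The cycle stays in its layer: `x_i(cyc y t) = x_i(y)`. [folklore] -/
theorem axisCoord_cyc (hij : i ≠ j) (y : TiltedSite d i j M M L) (t : ℕ) :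
    axisCoord d L M (cyc y t) = axisCoord d L M y := by
  rw [cyc, map_add, axisCoord_zsmul_tiltedUnit_right d L M hij, add_zero]

/-- The cycle closes after `2M` steps. [folklore] -/
theorem cyc_add_two_mul (hij : i ≠ j) (y : TiltedSite d i j M M L) (t : ℕ) : cyc y (t + 2 * M) = cyc y t := by
  rw [cyc, cyc, Nat.cast_add, add_zsmul, two_mul_zsmul_tiltedUnit_right d L M hij, add_zero]

/-- The cycle is periodic with period `2M`. [folklore] -/
theorem cyc_mod (hij : i ≠ j) (y : TiltedSite d i j M M L) (t : ℕ) : cyc y (t % (2 * M)) = cyc y t := by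
  conv_rhs => rw [← Nat.mod_add_div t (2 * M)]
  have : ∀ k : ℕ, cyc y (t % (2 * M) + 2 * M * k) = cyc y (t % (2 * M)) := by
    intro k
    induction k with
    | zero => simp
    | succ k ih => rw [Nat.mul_succ, ← add_assoc, cyc_add_two_mul hij, ih]
  rw [this]

/-- Half a period is the twist: `cyc y t + T = cyc y (t + M)`. [folklore] -/
theorem cyc_add_tiltedTwist (y : TiltedSite d i j M M L) (t : ℕ) :
    cyc y t + tiltedTwist d L M = cyc y (t + M) := by
  rw [cyc, cyc, tiltedTwist_eq_zsmul, Nat.cast_add, add_zsmul, add_assoc]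

/-- **The cycle is injective on `[0, 2M)`.** [folklore] -/
theorem cyc_inj (hij : i ≠ j) (y : TiltedSite d i j M M L) {s t : ℕ} (hs : s < 2 * M) (ht : t < 2 * M)
    (h : cyc y s = cyc y t) : s = t := by
  rw [cyc, cyc, add_right_inj, ← sub_eq_zero, ← sub_smul, zsmul_tiltedUnit_right_eq_zero_iff d L M hij] at h
  have h1 : ((2 * M : ℕ) : ℤ) ∣ (s : ℤ) - t := h
  rcases lt_trichotomy s t with hlt | heq | hgt
  · exfalso
    have h2 : ((2 * M : ℕ) : ℤ) ∣ (t : ℤ) - s := by rw [← neg_sub]; exact h1.neg_right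
    have h3 := Int.le_of_dvd (by omega) h2
    omega
  · exact heq
  · exfalso
    have h3 := Int.le_of_dvd (by omega) h1
    omega

/-! ## Two dimensions: the kernel of `x_i` is `⟨e_j⟩` -/

/-- **In two dimensions a site with `x_i ≡ 0 (mod M)` is a multiple of `e_j`**: for `x = (M a, b)`,
`x - (b + M a) e_j = (M a, -M a) ∈ Γ`. [folklore] -/
theorem eq_zsmul_of_axisCoord_eq_zero [NeZero M] (hij : i ≠ j) (hd : ∀ k : Fin d, k = i ∨ k = j)
    (q : TiltedSite d i j M M L) (hq : axisCoord d L M q = 0) :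
    ∃ n : ℕ, n < 2 * M ∧ q = (n : ℤ) • tiltedUnit d i j M M L j := by
  have hM : 0 < 2 * M := by have := NeZero.ne M; omega
  induction q using QuotientAddGroup.induction_on with
  | H x =>
    rw [axisCoord_mk, ZMod.intCast_zmod_eq_zero_iff_dvd] at hq
    obtain ⟨a, ha⟩ := hq
    -- `q = (x_j + M a) • e_j`
    have hq' : (x : TiltedSite d i j M M L) = (x j + M * a : ℤ) • tiltedUnit d i j M M L j := by
      rw [zsmul_tiltedUnit, QuotientAddGroup.eq, mem_tiltedLattice_iff]
      simp only [Pi.add_apply, Pi.neg_apply, Pi.single_eq_same, Pi.single_eq_of_ne hij]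
      refine ⟨⟨0, ?_⟩, ⟨-a, ?_⟩, fun k hki hkj => (hd k).elim (fun h => (hki h).elim) fun h => (hkj h).elim⟩
      · rw [ha]; push_cast; ring
      · rw [ha]; push_cast; ring
    -- reduce the coefficient mod `2M`
    set c : ℤ := x j + M * a with hc
    refine ⟨(c % (2 * M : ℕ)).toNat, ?_, ?_⟩
    · have h1 : (c % (2 * M : ℕ)) < (2 * M : ℕ) := Int.emod_lt_of_pos c (by exact_mod_cast hM)
      have h2 : 0 ≤ c % (2 * M : ℕ) := Int.emod_nonneg c (by exact_mod_cast hM.ne')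
      omega
    · rw [hq', Int.toNat_of_nonneg (Int.emod_nonneg c (by exact_mod_cast hM.ne')), ← sub_eq_zero,
        ← sub_smul, zsmul_tiltedUnit_right_eq_zero_iff d L M hij]
      exact ⟨c / ((2 * M : ℕ) : ℤ), by rw [Int.emod_def]; ring⟩

/-- **In two dimensions two sites of the same layer differ by a multiple of `e_j`.** [folklore] -/
theorem exists_eq_cyc_of_axisCoord_eq [NeZero M] (hij : i ≠ j) (hd : ∀ k : Fin d, k = i ∨ k = j)
    {q y : TiltedSite d i j M M L} (h : axisCoord d L M q = axisCoord d L M y) :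
    ∃ t : ℕ, t < 2 * M ∧ q = cyc y t := by
  obtain ⟨n, hn, hq⟩ := eq_zsmul_of_axisCoord_eq_zero hij hd (q - y) (by rw [map_sub, h, sub_self])
  exact ⟨n, hn, by rw [cyc, ← hq, add_sub_cancel]⟩

/-- **A layer is one cycle**: `{q : x_i(q) = x_i(y)} = {cyc y t : t < 2M}`. [folklore] -/
theorem filter_axisCoord_eq_image_cyc [NeZero M] [NeZero L] [DecidableEq (TiltedSite d i j M M L)]
    (hij : i ≠ j) (hd : ∀ k : Fin d, k = i ∨ k = j) (y : TiltedSite d i j M M L) :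
    Finset.univ.filter (fun q => axisCoord d L M q = axisCoord d L M y) = (Finset.range (2 * M)).image (cyc y) := by
  ext q
  simp only [Finset.mem_filter, Finset.mem_univ, true_and, Finset.mem_image, Finset.mem_range]
  constructor
  · intro h
    obtain ⟨t, ht, rfl⟩ := exists_eq_cyc_of_axisCoord_eq hij hd h
    exact ⟨t, ht, rfl⟩
  · rintro ⟨t, -, rfl⟩
    exact axisCoord_cyc hij y t

/-! ## Two dimensions: the direction pair -/

/-- The direction pair `{i, j}`, ordered. -/
abbrev dp (hij : i ≠ j) : DirPair d := mkDirPair i j (Ne.symm hij)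

/-- **In two dimensions there is one direction pair.** [folklore] -/
theorem dirPair_eq_dp (hij : i ≠ j) (hd : ∀ k : Fin d, k = i ∨ k = j) (q : DirPair d) : q = dp hij := by
  obtain ⟨⟨a, b⟩, hab⟩ := q
  have hne : a ≠ b := ne_of_lt hab
  unfold dp mkDirPair
  rcases hd a with rfl | rfl <;> rcases hd b with rfl | rfl
  · exact (hne rfl).elim
  · rw [dif_pos hab]
  · have : ¬ b < a := not_lt.2 hab.le
    rw [dif_neg this]
  · exact (hne rfl).elim

/-- In two dimensions every plaquette has an `i`-side. [folklore] -/
theorem hasDir_left (hij : i ≠ j) (hd : ∀ k : Fin d, k = i ∨ k = j) {A : Type*} (p : A × DirPair d) :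
    p.2.1.1 = i ∨ p.2.1.2 = i := by
  rw [dirPair_eq_dp hij hd p.2]
  exact mkDirPair_hasDir i j (Ne.symm hij)

end TwoDim

end TiltedRP

end Summit.QuantumFields.GaugeBoot

end
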